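/-
Copyright (c) 2026. All rights reserved.
Released under Apache 2.0 license as described in the file LICENSE.
Authors: abc-iut cell, prover seat abc-iut-w4-d017 (wave 4, gen 5).
-/
import Literature.IUT.LogVolume.UnitLogUnramifiedDyadic
import Literature.IUT.LogVolume.LogSeriesEstimates
import HarnessLib

/-!
# Wild quadratic dyadic fields (`e = 2`, `f = 1` over `ℚ₂`): the lattice `log₂(𝒪_K^×)` EXACTLY

Proof-only companion (theorems, no definitions) of `UnitLogWildDyadic.lean` (abc-iut-w5-d172: for
`e(K/ℚ₂) = 2`, `f(K/ℚ₂) = 1` every unit logarithm has norm `≤ 2^{−1/2}`, i.e. `log₂(𝒪_K^×) ⊆ 𝔪_K`) and of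
`UnitLogUnramifiedDyadic.lean` (abc-iut-w5-d180: `L(1 − 2w) ≡ −2w(1 + w) (mod 4)`).  Classical `2`-adic analysis
(Neukirch, *Algebraic Number Theory*, Ch. II (5.5)); nothing here is disputed mathematics and no IUT statement is
asserted.

Let `K` be a complete ultrametric normed `ℚ₂`-algebra field with `e = 2`, `f = 1` — the completions of number
fields at places `v ∣ 2` with `e(v|2) = 2`, `f(v|2) = 1`, e.g. the six ramified quadratic extensions
`ℚ₂(√−1), ℚ₂(√3), ℚ₂(√±2), ℚ₂(√±6)` of `ℚ₂` — and let `ϖ` be a (norm) uniformizer, so `‖ϖ‖² = ‖2‖ = 1/2`,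
`𝔪ⁿ = {‖y‖ ≤ ‖ϖ‖ⁿ}`, `U_n = 1 + 𝔪ⁿ`, `𝒪^× = U_1` (`f = 1`).  The boundary index is `n = e/(p − 1) = 2`:

* §3 `norm_logSeries_one_sub_two_mul_le` — **`log₂(U_2) ⊆ 𝔪³`**: for `‖w‖ ≤ 1`, `‖L(1 − 2w)‖ ≤ ‖ϖ‖³`
  (`L(1 − 2w) ≡ −2w(1+w) (mod 4)` and, by `f = 1`, one of `w`, `1 + w` lies in `𝔪`);
* §4 `closedBall_subset_logUnits` — **`𝔪³ ⊆ log₂(𝒪^×)`** (`L : U_3 ↠ 𝔪³`, successive approximation);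
* §5 `norm_unitLog_sub_unitLog_le` — for `u, u₀ ∈ U_1 ∖ U_2` (`‖1 − u‖ = ‖1 − u₀‖ = ‖ϖ‖`), `u/u₀ ∈ U_2`, so
  `‖log₂ u − log₂ u₀‖ ≤ ‖ϖ‖³`;
* §6 **`logUnits_eq_union`**: for ANY `u₀ ∈ U_1 ∖ U_2`, writing `λ := log₂ u₀`,

    `log₂(𝒪_K^×) = 𝔪³ ∪ (λ + 𝔪³)`,  `2λ ∈ 𝔪³`  (`[log₂(𝒪^×) : 𝔪³] ≤ 2`);

  and `U_2` stabilises: `smul_logUnits_eq_of_norm_one_sub_le`.  The TRICHOTOMY on `‖λ‖ ∈ {≤ ‖ϖ‖³, ‖ϖ‖², ‖ϖ‖}`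
  (`log₂(𝒪^×) = 𝔪³` · `= 𝔪²` · NOT an `𝒪_K`-module; realised by `ℚ₂(√−1)` · `ℚ₂(√3)` · `ℚ₂(√±2), ℚ₂(√±6)`) is the
  sibling file `UnitLogWildQuadraticDyadicCases.lean`.

Consumer: the abc-iut cell's TEAM R «ismDH mover» thread (ball criterion `Thm311RealIsmDHMoverCriterion`,
shell-multiple criterion `Thm311RealIsmDHStableLattices` / `Thm311RealIsmDHUnramifiedDyadicUnits`): the
`e = 2`, `f = 1` cell of the over-`2` column.  [cite: NeukirchANT1999, Ch. II Prop. (5.5)]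
-/

noncomputable section

open Metric Set IsLocalRing
open scoped Pointwise

namespace Literature.IUT.LogVolume

namespace WildQuadraticDyadic

open Literature.NumberTheory.GaloisRepresentations.Ultrametric

variable {K : Type*} [NontriviallyNormedField K] [NormedAlgebra ℚ_[2] K]

/-! ## 1. Numerology at `e = 2`: `‖ϖ‖² = 1/2 = ‖2‖`, `‖ϖ‖³ > 1/4`, discreteness -/

section Uniformizer

variable [IsUltrametricDist K] [ProperSpace K] {ϖ : Kˣ} (hϖ : IsUniformizer ϖ)
include hϖ

/-- `‖ϖ‖² = 1/2` for a uniformizer at `e = 2`. [cite: NeukirchANT1999, Ch. II Prop. (5.5)] -/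
theorem norm_unif_sq (he : absRamificationIdx 2 K = 2) : ‖(ϖ : K)‖ ^ 2 = 2⁻¹ := by
  have h := norm_pow_absRamificationIdx 2 K hϖ
  rw [he] at h
  exact_mod_cast h

/-- `‖ϖ‖² = ‖2‖`. [cite: NeukirchANT1999, Ch. II Prop. (5.5)] -/
theorem norm_unif_sq_eq_norm_two (he : absRamificationIdx 2 K = 2) : ‖(ϖ : K)‖ ^ 2 = ‖(2 : K)‖ := by
  rw [norm_unif_sq hϖ he, WildDyadic.norm_two]

/-- `‖ϖ‖³ = ‖2‖·‖ϖ‖ = ‖ϖ‖/2`. [cite: NeukirchANT1999, Ch. II Prop. (5.5)] -/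
theorem norm_unif_pow_three (he : absRamificationIdx 2 K = 2) : ‖(ϖ : K)‖ ^ 3 = 2⁻¹ * ‖(ϖ : K)‖ := by
  rw [pow_succ, norm_unif_sq hϖ he]

/-- `1/2 < ‖ϖ‖` (`‖ϖ‖² = 1/2`, `‖ϖ‖ < 1`). [cite: NeukirchANT1999, Ch. II Prop. (5.5)] -/
theorem half_lt_norm_unif (he : absRamificationIdx 2 K = 2) : 2⁻¹ < ‖(ϖ : K)‖ := by
  have h0 : 0 < ‖(ϖ : K)‖ := norm_units_pos ϖ
  have h1 : ‖(ϖ : K)‖ < 1 := hϖ.1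
  rw [← norm_unif_sq hϖ he]
  nlinarith

/-- `1/4 < ‖ϖ‖³`. [cite: NeukirchANT1999, Ch. II Prop. (5.5)] -/
theorem quarter_lt_norm_unif_pow_three (he : absRamificationIdx 2 K = 2) : 4⁻¹ < ‖(ϖ : K)‖ ^ 3 := by
  rw [norm_unif_pow_three hϖ he]
  have := half_lt_norm_unif hϖ he
  nlinarith

omit [NormedAlgebra ℚ_[2] K] [IsUltrametricDist K] [ProperSpace K] in
/-- **Discreteness**: `‖z‖ < ‖ϖ‖^m ⇒ ‖z‖ ≤ ‖ϖ‖^{m+1}`. [cite: NeukirchANT1999, Ch. II Prop. (3.8)] -/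
theorem norm_le_zpow_succ_of_norm_lt_zpow {z : K} {m : ℤ} (hz : ‖z‖ < ‖(ϖ : K)‖ ^ m) :
    ‖z‖ ≤ ‖(ϖ : K)‖ ^ (m + 1) := by
  by_cases hz0 : z = 0
  · rw [hz0, norm_zero]; positivity
  · obtain ⟨k, hk⟩ := hϖ.2 (Units.mk0 z hz0)
    rw [Units.val_mk0] at hk
    rw [hk] at hz ⊢
    have hanti : StrictAnti fun n : ℤ => ‖(ϖ : K)‖ ^ n := zpow_right_strictAnti₀ (norm_units_pos ϖ) hϖ.1
    have hmk : m < k := hanti.lt_iff_gt.mp hz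
    exact hanti.antitone (show m + 1 ≤ k by omega)

omit [NormedAlgebra ℚ_[2] K] [IsUltrametricDist K] [ProperSpace K] in
/-- `‖z‖ < ‖ϖ‖ ⇒ ‖z‖ ≤ ‖ϖ‖²`. [cite: NeukirchANT1999, Ch. II Prop. (3.8)] -/
theorem norm_le_sq_of_norm_lt_unif {z : K} (hz : ‖z‖ < ‖(ϖ : K)‖) : ‖z‖ ≤ ‖(ϖ : K)‖ ^ 2 := by
  have h := norm_le_zpow_succ_of_norm_lt_zpow hϖ (m := 1) (by rwa [zpow_one])
  rwa [show (1 : ℤ) + 1 = ((2 : ℕ) : ℤ) by norm_num, zpow_natCast] at h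

omit [NormedAlgebra ℚ_[2] K] [IsUltrametricDist K] [ProperSpace K] in
/-- `‖z‖ < ‖ϖ‖² ⇒ ‖z‖ ≤ ‖ϖ‖³`. [cite: NeukirchANT1999, Ch. II Prop. (3.8)] -/
theorem norm_le_cube_of_norm_lt_sq {z : K} (hz : ‖z‖ < ‖(ϖ : K)‖ ^ 2) : ‖z‖ ≤ ‖(ϖ : K)‖ ^ 3 := by
  have h := norm_le_zpow_succ_of_norm_lt_zpow hϖ (m := 2) (by exact_mod_cast hz)
  rwa [show (2 : ℤ) + 1 = ((3 : ℕ) : ℤ) by norm_num, zpow_natCast] at h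

end Uniformizer

/-! ## 2. `f = 1`: units are principal; `‖1 + w‖ ≤ ‖ϖ‖` for a unit `w` -/

section ResidueOne

variable [IsUltrametricDist K] [ProperSpace K] {ϖ : Kˣ} (hϖ : IsUniformizer ϖ)
include hϖ

/-- For a unit `w` (`f = 1`): `‖1 − w‖ ≤ ‖ϖ‖`. [cite: NeukirchANT1999, Ch. II Prop. (5.3)] -/
theorem norm_one_sub_le_unif (hf : residueDegree 2 K = 1) {w : K} (hw : ‖w‖ = 1) : ‖1 - w‖ ≤ ‖(ϖ : K)‖ :=
  hϖ.norm_le_of_norm_lt_one _ (WildDyadic.isPrincipal_of_residueDegree_eq_one hf hw)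

/-- For a unit `w` (`e = 2`, `f = 1`): `‖1 + w‖ ≤ ‖ϖ‖` (`1 + w = 2 − (1 − w)`).
[cite: NeukirchANT1999, Ch. II Prop. (5.3)] -/
theorem norm_one_add_le_unif (he : absRamificationIdx 2 K = 2) (hf : residueDegree 2 K = 1) {w : K}
    (hw : ‖w‖ = 1) : ‖1 + w‖ ≤ ‖(ϖ : K)‖ := by
  have h2 : ‖(2 : K)‖ ≤ ‖(ϖ : K)‖ := by
    rw [← norm_unif_sq_eq_norm_two hϖ he, sq]
    exact mul_le_of_le_one_left (norm_nonneg _) hϖ.1.le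
  rw [show (1 : K) + w = 2 + -(1 - w) by ring]
  refine (IsUltrametricDist.norm_add_le_max _ _).trans (max_le h2 ?_)
  rw [norm_neg]
  exact norm_one_sub_le_unif hϖ hf hw

/-- **Dichotomy `U_1 = U_2 ⊔ (U_1 ∖ U_2)`**: a unit `u` has `‖1 − u‖ ≤ ‖ϖ‖²` or `‖1 − u‖ = ‖ϖ‖`.
[cite: NeukirchANT1999, Ch. II Prop. (5.3)] -/
theorem norm_one_sub_le_sq_or_eq (hf : residueDegree 2 K = 1) {u : K} (hu : ‖u‖ = 1) :
    ‖1 - u‖ ≤ ‖(ϖ : K)‖ ^ 2 ∨ ‖1 - u‖ = ‖(ϖ : K)‖ := by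
  rcases (norm_one_sub_le_unif hϖ hf hu).lt_or_eq with h | h
  · exact Or.inl (norm_le_sq_of_norm_lt_unif hϖ h)
  · exact Or.inr h

/-- Two elements of norm EXACTLY `‖ϖ‖` differ by an element of `𝔪²` (`f = 1`: `𝔪/𝔪²` has two elements).
[cite: NeukirchANT1999, Ch. II Prop. (5.3)] -/
theorem norm_sub_le_sq_of_norm_eq (hf : residueDegree 2 K = 1) {x x₀ : K} (hx : ‖x‖ = ‖(ϖ : K)‖)
    (hx₀ : ‖x₀‖ = ‖(ϖ : K)‖) : ‖x₀ - x‖ ≤ ‖(ϖ : K)‖ ^ 2 := by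
  have h0 : x₀ ≠ 0 := norm_pos_iff.mp (by rw [hx₀]; exact norm_units_pos ϖ)
  have hq : ‖x / x₀‖ = 1 := by rw [norm_div, hx, hx₀, div_self (norm_units_pos ϖ).ne']
  have hP : ‖1 - x / x₀‖ < 1 := WildDyadic.isPrincipal_of_residueDegree_eq_one hf hq
  have heq : x₀ - x = x₀ * (1 - x / x₀) := by field_simp
  have hlt : ‖x₀ - x‖ < ‖(ϖ : K)‖ := by
    rw [heq, norm_mul, hx₀]
    calc ‖(ϖ : K)‖ * ‖1 - x / x₀‖ < ‖(ϖ : K)‖ * 1 := by gcongr; exact norm_units_pos ϖ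
      _ = ‖(ϖ : K)‖ := mul_one _
  exact norm_le_sq_of_norm_lt_unif hϖ hlt

/-- Two elements of the same norm differ by something of smaller norm, hence of norm `≤ ‖ϖ‖·‖x₀‖` (`f = 1`).
[cite: NeukirchANT1999, Ch. II Prop. (5.3)] -/
theorem norm_sub_le_unif_mul_of_norm_eq (hf : residueDegree 2 K = 1) {x x₀ : K} (hx₀0 : x₀ ≠ 0)
    (hx : ‖x‖ = ‖x₀‖) : ‖x₀ - x‖ ≤ ‖(ϖ : K)‖ * ‖x₀‖ := by
  have hn0 : 0 < ‖x₀‖ := norm_pos_iff.mpr hx₀0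
  have hq : ‖x / x₀‖ = 1 := by rw [norm_div, hx, div_self hn0.ne']
  have hP : ‖1 - x / x₀‖ < 1 := WildDyadic.isPrincipal_of_residueDegree_eq_one hf hq
  have heq : x₀ - x = x₀ * (1 - x / x₀) := by field_simp
  rw [heq, norm_mul]
  calc ‖x₀‖ * ‖1 - x / x₀‖ ≤ ‖x₀‖ * ‖(ϖ : K)‖ := by gcongr; exact hϖ.norm_le_of_norm_lt_one _ hP
    _ = ‖(ϖ : K)‖ * ‖x₀‖ := mul_comm _ _

end ResidueOne

/-! ## 3. `log₂(U_2) ⊆ 𝔪³` — the boundary index `n = e/(p−1) = 2` -/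

section LogUTwo

variable [IsUltrametricDist K] [CompleteSpace K] [ProperSpace K] {ϖ : Kˣ} (hϖ : IsUniformizer ϖ)
include hϖ

omit [CompleteSpace K] in
/-- For `‖w‖ ≤ 1` (`e = 2`, `f = 1`): `‖2·w·(1 + w)‖ ≤ ‖ϖ‖³` — one of `w`, `1 + w` is in `𝔪`.
[cite: NeukirchANT1999, Ch. II Prop. (5.5)] -/
theorem norm_two_mul_mul_one_add_le (he : absRamificationIdx 2 K = 2) (hf : residueDegree 2 K = 1) {w : K}
    (hw : ‖w‖ ≤ 1) : ‖2 * w * (1 + w)‖ ≤ ‖(ϖ : K)‖ ^ 3 := by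
  rw [norm_mul, norm_mul, ← norm_unif_sq_eq_norm_two hϖ he,
    show ‖(ϖ : K)‖ ^ 3 = ‖(ϖ : K)‖ ^ 2 * ‖(ϖ : K)‖ by ring]
  rcases hw.lt_or_eq with hlt | heq
  · have h1 : ‖1 + w‖ ≤ 1 := (IsUltrametricDist.norm_add_le_max _ _).trans (max_le (by rw [norm_one]) hw)
    have h2 : ‖w‖ ≤ ‖(ϖ : K)‖ := hϖ.norm_le_of_norm_lt_one _ hlt
    calc ‖(ϖ : K)‖ ^ 2 * ‖w‖ * ‖1 + w‖ ≤ ‖(ϖ : K)‖ ^ 2 * ‖(ϖ : K)‖ * 1 := by gcongr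
      _ = ‖(ϖ : K)‖ ^ 2 * ‖(ϖ : K)‖ := mul_one _
  · rw [heq, mul_one]
    gcongr
    exact norm_one_add_le_unif hϖ he hf heq

/-- **`log₂(U_2) ⊆ 𝔪³`**: for `‖w‖ ≤ 1`, `‖L(1 − 2w)‖ ≤ ‖ϖ‖³` (`L(1 − 2w) ≡ −2w(1+w) (mod 4)`, abc-iut-w5-d180's
`UnramifiedDyadic.norm_logSeries_add_le_quarter`, and `‖4‖ = ‖ϖ‖⁴`). [cite: NeukirchANT1999, Ch. II Prop. (5.5)] -/
theorem norm_logSeries_one_sub_two_mul_le (he : absRamificationIdx 2 K = 2) (hf : residueDegree 2 K = 1)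
    {w : K} (hw : ‖w‖ ≤ 1) : ‖logSeries (1 - 2 * w)‖ ≤ ‖(ϖ : K)‖ ^ 3 := by
  have hq := UnramifiedDyadic.norm_logSeries_add_le_quarter (K := K) hw
  have hmain := norm_two_mul_mul_one_add_le hϖ he hf hw
  have h4 : (4⁻¹ : ℝ) ≤ ‖(ϖ : K)‖ ^ 3 := (quarter_lt_norm_unif_pow_three hϖ he).le
  rw [show logSeries (1 - 2 * w) = (logSeries (1 - 2 * w) + 2 * w * (1 + w)) + -(2 * w * (1 + w)) by ring]
  refine (IsUltrametricDist.norm_add_le_max _ _).trans (max_le (hq.trans h4) ?_)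
  rwa [norm_neg]

/-- **`log₂ u ∈ 𝔪³` for `u ∈ U_2`**: `‖1 − u‖ ≤ ‖ϖ‖² = ‖2‖ ⇒ ‖log₂ u‖ ≤ ‖ϖ‖³`.
[cite: NeukirchANT1999, Ch. II Prop. (5.5)] -/
theorem norm_unitLog_le_of_norm_one_sub_le_sq (he : absRamificationIdx 2 K = 2) (hf : residueDegree 2 K = 1)
    {u : K} (hu : ‖1 - u‖ ≤ ‖(ϖ : K)‖ ^ 2) : ‖unitLog u‖ ≤ ‖(ϖ : K)‖ ^ 3 := by
  have h2 : (2 : K) ≠ 0 := by rw [← norm_pos_iff, WildDyadic.norm_two]; norm_num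
  set w : K := (1 - u) / 2 with hwdef
  have hw : ‖w‖ ≤ 1 := by
    rw [hwdef, norm_div, ← norm_unif_sq_eq_norm_two hϖ he, div_le_one (by rw [norm_unif_sq hϖ he]; norm_num)]
    exact hu
  have hu' : u = 1 - 2 * w := by rw [hwdef]; field_simp; ring
  have hP : IsPrincipal u := by
    show ‖1 - u‖ < 1
    refine hu.trans_lt ?_
    rw [norm_unif_sq hϖ he]; norm_num
  rw [unitLog_of_isPrincipal 2 hP, hu']
  exact norm_logSeries_one_sub_two_mul_le hϖ he hf hw

/-- **`log₂(U_1²) ⊆ 𝔪³`**: for every unit `u`, `‖log₂(u²)‖ ≤ ‖ϖ‖³` (`1 − u² = (1 − u)(1 + u)` has norm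
`≤ ‖ϖ‖·‖ϖ‖`); hence `‖2·log₂ u‖ ≤ ‖ϖ‖³` and `‖log₂ u‖ ≤ ‖ϖ‖` (abc-iut-w5-d172's bound, recovered).
[cite: NeukirchANT1999, Ch. II Prop. (5.5)] -/
theorem norm_unitLog_sq_le (he : absRamificationIdx 2 K = 2) (hf : residueDegree 2 K = 1) {u : K}
    (hu : ‖u‖ = 1) : ‖unitLog (u ^ 2)‖ ≤ ‖(ϖ : K)‖ ^ 3 := by
  refine norm_unitLog_le_of_norm_one_sub_le_sq hϖ he hf ?_
  rw [show (1 : K) - u ^ 2 = (1 - u) * (1 + u) by ring, norm_mul, sq]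
  exact mul_le_mul (norm_one_sub_le_unif hϖ hf hu) (norm_one_add_le_unif hϖ he hf hu) (norm_nonneg _)
    (norm_nonneg _)

/-- `‖2 · log₂ u‖ ≤ ‖ϖ‖³` for every unit `u`. [cite: NeukirchANT1999, Ch. II Prop. (5.5)] -/
theorem norm_two_mul_unitLog_le (he : absRamificationIdx 2 K = 2) (hf : residueDegree 2 K = 1) {u : K}
    (hu : ‖u‖ = 1) : ‖2 * unitLog u‖ ≤ ‖(ϖ : K)‖ ^ 3 := by
  have h := norm_unitLog_sq_le hϖ he hf hu
  rwa [unitLog_pow 2 hu 2, Nat.cast_ofNat] at h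

/-- `‖log₂ u‖ ≤ ‖ϖ‖` for every `u` (junk value `0` off the unit sphere). [cite: NeukirchANT1999, Ch. II Prop. (5.5)] -/
theorem norm_unitLog_le_unif (he : absRamificationIdx 2 K = 2) (hf : residueDegree 2 K = 1) (u : K) :
    ‖unitLog u‖ ≤ ‖(ϖ : K)‖ := by
  by_cases hu : ‖u‖ = 1
  · have h := norm_two_mul_unitLog_le hϖ he hf hu
    rw [norm_mul, ← norm_unif_sq_eq_norm_two hϖ he,
      show ‖(ϖ : K)‖ ^ 3 = ‖(ϖ : K)‖ ^ 2 * ‖(ϖ : K)‖ by ring] at h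
    exact le_of_mul_le_mul_left h (pow_pos (norm_units_pos ϖ) 2)
  · rw [unitLog_of_norm_ne_one hu, norm_zero]; exact norm_nonneg _

end LogUTwo

/-! ## 4. `𝔪³ ⊆ log₂(𝒪^×)`: `L` maps `U_3` onto `𝔪³` -/

section LogUThree

variable [IsUltrametricDist K] [CompleteSpace K] [ProperSpace K] {ϖ : Kˣ} (hϖ : IsUniformizer ϖ)
include hϖ

/-- **`L : U_3 ↠ 𝔪³`**: every `z` with `‖z‖ ≤ ‖ϖ‖³` is `log₂ u` for some `u` with `‖1 − u‖ ≤ ‖ϖ‖³`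
(`‖ϖ‖³·2 = ‖ϖ‖ < 1`: successive approximation, campaign-S `exists_logSeries_eq`).
[cite: NeukirchANT1999, Ch. II Prop. (5.5)] -/
theorem exists_unitLog_eq_of_norm_le_cube (he : absRamificationIdx 2 K = 2) {z : K} (hz : ‖z‖ ≤ ‖(ϖ : K)‖ ^ 3) :
    ∃ u : K, ‖1 - u‖ ≤ ‖(ϖ : K)‖ ^ 3 ∧ unitLog u = z := by
  have h2 : ((2 : ℕ) : ℝ) ^ (1 / (((2 : ℕ) : ℝ) - 1)) = 2 := by norm_num
  have hθ : ‖(ϖ : K)‖ ^ 3 * ((2 : ℕ) : ℝ) ^ (1 / (((2 : ℕ) : ℝ) - 1)) < 1 := by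
    rw [h2, norm_unif_pow_three hϖ he]
    have := hϖ.1
    linarith
  obtain ⟨u, hu, huz⟩ := exists_logSeries_eq 2 K hθ hz
  have hP : IsPrincipal u := by
    show ‖1 - u‖ < 1
    refine hu.trans_lt ((pow_lt_one_iff_of_nonneg (norm_nonneg _) (by norm_num)).mpr hϖ.1)
  exact ⟨u, hu, by rw [unitLog_of_isPrincipal 2 hP, huz]⟩

/-- **`𝔪³ ⊆ log₂(𝒪_K^×)`.** [cite: NeukirchANT1999, Ch. II Prop. (5.5)] -/
theorem closedBall_subset_logUnits (he : absRamificationIdx 2 K = 2) :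
    closedBall (0 : K) (‖(ϖ : K)‖ ^ 3) ⊆ logUnits K := fun z hz => by
  rw [mem_closedBall_zero_iff] at hz
  obtain ⟨u, hu, huz⟩ := exists_unitLog_eq_of_norm_le_cube hϖ he hz
  have hP : IsPrincipal u :=
    hu.trans_lt ((pow_lt_one_iff_of_nonneg (norm_nonneg _) (by norm_num)).mpr hϖ.1)
  exact ⟨u, hP.norm_eq_one, huz⟩

/-- `λ + 𝔪³ ⊆ log₂(𝒪_K^×)` for every `λ ∈ log₂(𝒪_K^×)` (a subgroup containing `𝔪³`).
[cite: NeukirchANT1999, Ch. II Prop. (5.5)] -/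
theorem closedBall_subset_logUnits_of_mem (he : absRamificationIdx 2 K = 2) {lam : K} (hlam : lam ∈ logUnits K) :
    closedBall lam (‖(ϖ : K)‖ ^ 3) ⊆ logUnits K := fun z hz => by
  rw [mem_closedBall, dist_eq_norm] at hz
  have h1 : z - lam ∈ logUnits K := closedBall_subset_logUnits hϖ he (mem_closedBall_zero_iff.mpr hz)
  have h2 : (z - lam) + lam ∈ (logUnitsAddSubgroup 2 K : AddSubgroup K) :=
    (logUnitsAddSubgroup 2 K).add_mem h1 hlam
  rwa [sub_add_cancel] at h2

end LogUThree

/-! ## 5. `u, u₀ ∈ U_1 ∖ U_2 ⇒ log₂ u ≡ log₂ u₀ (mod 𝔪³)` -/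

section Coset

variable [IsUltrametricDist K] [CompleteSpace K] [ProperSpace K] {ϖ : Kˣ} (hϖ : IsUniformizer ϖ)
include hϖ

/-- **For `‖1 − u‖ = ‖1 − u₀‖ = ‖ϖ‖`: `‖log₂ u − log₂ u₀‖ ≤ ‖ϖ‖³`** (`u·u₀⁻¹ ∈ U_2` since `𝔪/𝔪²` has two
elements, then §3). [cite: NeukirchANT1999, Ch. II Prop. (5.5)] -/
theorem norm_unitLog_sub_unitLog_le (he : absRamificationIdx 2 K = 2) (hf : residueDegree 2 K = 1) {u u₀ : K}
    (hu : ‖1 - u‖ = ‖(ϖ : K)‖) (hu₀ : ‖1 - u₀‖ = ‖(ϖ : K)‖) :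
    ‖unitLog u - unitLog u₀‖ ≤ ‖(ϖ : K)‖ ^ 3 := by
  have hu1 : ‖u‖ = 1 := IsPrincipal.norm_eq_one (show ‖1 - u‖ < 1 by rw [hu]; exact hϖ.1)
  have hu₀1 : ‖u₀‖ = 1 := IsPrincipal.norm_eq_one (show ‖1 - u₀‖ < 1 by rw [hu₀]; exact hϖ.1)
  have hu₀0 : u₀ ≠ 0 := norm_pos_iff.mp (by rw [hu₀1]; exact one_pos)
  have hinv : ‖u₀⁻¹‖ = 1 := by rw [norm_inv, hu₀1, inv_one]
  have hq : unitLog (u * u₀⁻¹) = unitLog u - unitLog u₀ := by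
    rw [unitLog_mul 2 hu1 hinv, unitLog_inv 2 hu₀1, sub_eq_add_neg]
  rw [← hq]
  refine norm_unitLog_le_of_norm_one_sub_le_sq hϖ he hf ?_
  have heq : 1 - u * u₀⁻¹ = ((1 - u) - (1 - u₀)) * u₀⁻¹ := by field_simp; ring
  rw [heq, norm_mul, hinv, mul_one, ← norm_neg, neg_sub]
  exact norm_sub_le_sq_of_norm_eq hϖ hf hu hu₀

end Coset

/-! ## 6. `log₂(𝒪_K^×) = 𝔪³ ∪ (λ + 𝔪³)` -/

section Union

variable [IsUltrametricDist K] [CompleteSpace K] [ProperSpace K] {ϖ : Kˣ} (hϖ : IsUniformizer ϖ)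
include hϖ

/-- **THE LATTICE `log₂(𝒪_K^×)` (`e = 2`, `f = 1`)**: for ANY `u₀` with `‖1 − u₀‖ = ‖ϖ‖` (`u₀ ∈ U_1 ∖ U_2`),
`log₂(𝒪_K^×) = 𝔪³ ∪ (log₂ u₀ + 𝔪³)` — as balls: `{‖z‖ ≤ ‖ϖ‖³} ∪ {‖z − log₂ u₀‖ ≤ ‖ϖ‖³}`.
[cite: NeukirchANT1999, Ch. II Prop. (5.5)] -/
theorem logUnits_eq_union (he : absRamificationIdx 2 K = 2) (hf : residueDegree 2 K = 1) {u₀ : K}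
    (hu₀ : ‖1 - u₀‖ = ‖(ϖ : K)‖) :
    logUnits K = closedBall (0 : K) (‖(ϖ : K)‖ ^ 3) ∪ closedBall (unitLog u₀) (‖(ϖ : K)‖ ^ 3) := by
  have hu₀1 : ‖u₀‖ = 1 := IsPrincipal.norm_eq_one (show ‖1 - u₀‖ < 1 by rw [hu₀]; exact hϖ.1)
  refine Subset.antisymm ?_ (union_subset (closedBall_subset_logUnits hϖ he)
    (closedBall_subset_logUnits_of_mem hϖ he (unitLog_mem_logUnits hu₀1)))
  rintro _ ⟨u, hu, rfl⟩
  change ‖u‖ = 1 at hu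
  rcases norm_one_sub_le_sq_or_eq hϖ hf hu with h | h
  · exact Or.inl (mem_closedBall_zero_iff.mpr (norm_unitLog_le_of_norm_one_sub_le_sq hϖ he hf h))
  · right
    rw [mem_closedBall, dist_eq_norm]
    exact norm_unitLog_sub_unitLog_le hϖ he hf h hu₀

/-- Membership form: `z ∈ log₂(𝒪_K^×) ↔ ‖z‖ ≤ ‖ϖ‖³ ∨ ‖z − log₂ u₀‖ ≤ ‖ϖ‖³`.
[cite: NeukirchANT1999, Ch. II Prop. (5.5)] -/
theorem mem_logUnits_iff_norm (he : absRamificationIdx 2 K = 2) (hf : residueDegree 2 K = 1) {u₀ : K}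
    (hu₀ : ‖1 - u₀‖ = ‖(ϖ : K)‖) (z : K) :
    z ∈ logUnits K ↔ ‖z‖ ≤ ‖(ϖ : K)‖ ^ 3 ∨ ‖z - unitLog u₀‖ ≤ ‖(ϖ : K)‖ ^ 3 := by
  rw [logUnits_eq_union hϖ he hf hu₀, mem_union, mem_closedBall_zero_iff, mem_closedBall, dist_eq_norm]

/-- **`U_2` stabilises `log₂(𝒪_K^×)`** in every case: `‖1 − w‖ ≤ ‖ϖ‖² ⇒ w · log₂(𝒪_K^×) = log₂(𝒪_K^×)`
(`w·𝔪³ = 𝔪³`, `‖wλ − λ‖ ≤ ‖ϖ‖·‖ϖ‖²`). [cite: NeukirchANT1999, Ch. II Prop. (5.5)] -/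
theorem smul_logUnits_eq_of_norm_one_sub_le (he : absRamificationIdx 2 K = 2) (hf : residueDegree 2 K = 1)
    {w : K} (hw : ‖1 - w‖ ≤ ‖(ϖ : K)‖ ^ 2) : w • logUnits K = logUnits K := by
  obtain ⟨u₀, hu₀⟩ : ∃ u₀ : K, ‖1 - u₀‖ = ‖(ϖ : K)‖ :=
    ⟨1 - ϖ, by rw [sub_sub_cancel]⟩
  have hw1 : ‖w‖ = 1 := IsPrincipal.norm_eq_one (show ‖1 - w‖ < 1 from
    hw.trans_lt ((pow_lt_one_iff_of_nonneg (norm_nonneg _) (by norm_num)).mpr hϖ.1))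
  have hw0 : w ≠ 0 := norm_pos_iff.mp (by rw [hw1]; exact one_pos)
  have hlam : ‖unitLog u₀‖ ≤ ‖(ϖ : K)‖ := norm_unitLog_le_unif hϖ he hf u₀
  -- the criterion `‖z‖ ≤ ϖ³ ∨ ‖z − λ‖ ≤ ϖ³` is invariant under `z ↦ w z`
  have key : ∀ z : K, (‖z‖ ≤ ‖(ϖ : K)‖ ^ 3 ∨ ‖z - unitLog u₀‖ ≤ ‖(ϖ : K)‖ ^ 3) ↔
      (‖w * z‖ ≤ ‖(ϖ : K)‖ ^ 3 ∨ ‖w * z - unitLog u₀‖ ≤ ‖(ϖ : K)‖ ^ 3) := fun z => by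
    rw [norm_mul, hw1, one_mul]
    have hmove : ‖w * z - unitLog u₀ - (w * (z - unitLog u₀))‖ ≤ ‖(ϖ : K)‖ ^ 3 := by
      rw [show w * z - unitLog u₀ - w * (z - unitLog u₀) = -((1 - w) * unitLog u₀) by ring, norm_neg,
        norm_mul, pow_succ]
      exact mul_le_mul hw hlam (norm_nonneg _) (by positivity)
    have hwz : ‖w * (z - unitLog u₀)‖ = ‖z - unitLog u₀‖ := by rw [norm_mul, hw1, one_mul]
    constructor
    · rintro (h | h)
      · exact Or.inl h
      · right
        rw [show w * z - unitLog u₀ = (w * z - unitLog u₀ - w * (z - unitLog u₀)) + w * (z - unitLog u₀)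
          by ring]
        exact (IsUltrametricDist.norm_add_le_max _ _).trans (max_le hmove (by rwa [hwz]))
    · rintro (h | h)
      · exact Or.inl h
      · right
        rw [← hwz, show w * (z - unitLog u₀) = -(w * z - unitLog u₀ - w * (z - unitLog u₀)) +
          (w * z - unitLog u₀) by ring]
        exact (IsUltrametricDist.norm_add_le_max _ _).trans (max_le (by rwa [norm_neg]) h)
  ext z
  rw [mem_smul_set_iff_inv_smul_mem₀ hw0, mem_logUnits_iff_norm hϖ he hf hu₀,
    mem_logUnits_iff_norm hϖ he hf hu₀, key (w⁻¹ • z), smul_eq_mul, ← mul_assoc, mul_inv_cancel₀ hw0,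
    one_mul]

end Union

end WildQuadraticDyadic

end Literature.IUT.LogVolume

end
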